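import Literature.IUT.HodgeTheaters.DiscreteProfiniteConjugatesSurfaceLemma27
import Literature.IUT.HodgeTheaters.SurfaceGroupLemma27
import HarnessLib

/-!
# [IUTchI] Thm 2.6 / Cor 2.8 / Lem 2.7 (vi)(vii) AS TYPED, MODULO THE TWO CLASSICAL FACTS ONLY

Mochizuki, *Inter-universal Teichmüller theory I*, kurims manuscript (May 2020), §2, Theorem 2.6
"Profinite Conjugates of Discrete Subgroups" p. 56 (proof pp. 56–57), Lemma 2.7 p. 57, Corollary 2.8
p. 59 [cite: Mochizuki2012, Thm 2.6 pp.56-59] (D-0012 claim key; series status DISPUTED — the items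
here are classical group theory; Remark 2.8.1: the surface case is off the IUT route).

PROOF-ONLY closer (abc-iut cell, DAG nodes `IUTchI:Thm2.6`, `IUTchI:Cor2.8`, `IUTchI:Lem2.7(vi)`,
`IUTchI:Lem2.7(vii)`; sub-DAG `plan/L5/SUBDAG-IUTchI-Thm26.md` residual row C1).
`DiscreteProfiniteConjugatesSurfaceLemma27.lean` (abc-iut-L5-d2) derives the four named statements of
`DiscreteProfiniteConjugates.lean` AS TYPED — `ProfiniteConjugatesOfDiscreteSubgroups` (Thm 2.6),
`SubgroupsOfComplexHyperbolicPi1` (Cor 2.8), `FreeOrSurface.centralizerCommutatorKernelTrivial`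
(Lem 2.7 (vi)), `FreeOrSurface.autFixingCommutatorKernelTrivial` (Lem 2.7 (vii)) — from the named
statements of Lemma 2.7 (i), (iii), (iv) AS TYPED plus the two classical NAMED FACTS
`SurfaceGroupConjugacySeparable` ([Stb2] = Stebe 1972 Thm 3.3, the input "[Stb2], Theorem 3.3" of the
printed proof p. 57 l. 9) and `SurfaceGroupFiniteIndexSubgroup` (Riemann–Hurwitz for finite-index
subgroups of surface groups, ZVC 1980 4.14.22) of
`Literature/GroupTheory/CombinatorialGroupTheory/SurfaceGroupConjugacySeparable.lean`.
Lemma 2.7 (i), (iii), (iv) are meanwhile THEOREMS of the tree for both free groups of finite rank and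
orientable surface groups: `FreeOrSurface.twoGeneratedSubgroupFree_holds`,
`FreeOrSurface.rankTwoInAbelianization_holds` (`SurfaceGroupLemma27.lean`, abc-iut-L5-d1, via
Baumslag's residual freeness of surface groups) and `FreeOrSurface.abelianSubgroupCyclic_holds`
(`SurfaceGroupLemma27iv.lean`, abc-iut-L5-d1).  THIS FILE plugs them in:

* `profiniteConjugatesOfDiscreteSubgroups_of_classicalFacts` — **Theorem 2.6 AS TYPED modulo exactly
  the two classical facts**; likewise `subgroupsOfComplexHyperbolicPi1_of_classicalFacts` (Cor 2.8),
  `centralizerCommutatorKernelTrivial_of_classicalFacts` (Lem 2.7 (vi)),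
  `autFixingCommutatorKernelTrivial_of_classicalFacts` (Lem 2.7 (vii));
* `isCyclic_centralizer_of_isFreeOrSurface` — the now UNCONDITIONAL classical corollary used on the
  way: in a free group of finite rank or an orientable surface group the centralizer of every
  non-trivial element is cyclic (from Lemma 2.7 (i) + (iv), `isCyclic_centralizer_of_lemma27`);
* `hcs_surface_of_classicalFacts` — hereditary conjugacy separability of orientable surface groups
  modulo the same two facts (re-export of `hcs_of_surfaceFacts` in the shape the §2 route consumes).

The free-group halves of all four statements are unconditional theorems of the tree (abc-iut-L5-t9,
`DiscreteProfiniteCompletionsAssembly.lean`).  Theorems only; no definitions, no new named facts;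
nothing is restated; typed ≠ proved for the two classical facts, which remain hypotheses BY NAME.
-/

namespace Literature.IUT.HodgeTheaters

open Literature.GroupTheory.CombinatorialGroupTheory (SurfaceGroupConjugacySeparable
  SurfaceGroupFiniteIndexSubgroup)

universe u

namespace FreeOrSurface

/-! ### The unconditional corollary: cyclic centralizers -/

/-- **Centralizers of non-trivial elements are cyclic** in a free group of finite rank or an orientable
surface group — UNCONDITIONAL (Lemma 2.7 (i) + (iv) of the tree, `isCyclic_centralizer_of_lemma27`).
[cite: Mochizuki2012, Lem 2.7(iv) p.57] -/
theorem isCyclic_centralizer_of_isFreeOrSurface {G : Type u} [Group G] (hG : IsFreeOrSurface G)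
    (u : G) (hu : u ≠ 1) : IsCyclic (Subgroup.centralizer ({u} : Set G)) :=
  isCyclic_centralizer_of_lemma27 G (twoGeneratedSubgroupFree_holds G hG)
    (abelianSubgroupCyclic_holds G hG) u hu

/-- The orientable-surface-group case of the cyclic-centralizer corollary, in the hypothesis shape
`(Z)` consumed by `DiscreteProfiniteConjugatesSurfaceHCS.lean` / `…SurfaceFacts.lean` — UNCONDITIONAL.
[cite: Mochizuki2012, Lem 2.7(iv) p.57] -/
theorem isCyclic_centralizer_surfaceCase :
    ∀ (S : Type u) [Group S], IsOrientableSurfaceGroup S → ∀ u : S, u ≠ 1 →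
      IsCyclic (Subgroup.centralizer ({u} : Set S)) :=
  isCyclic_centralizer_surfaceCase_of_lemma27 twoGeneratedSubgroupFree_holds abelianSubgroupCyclic_holds

/-! ### Hereditary conjugacy separability of surface groups modulo the two classical facts -/

/-- **(HCS) for orientable surface groups modulo [Stb2] + Riemann–Hurwitz**: every finite-index subgroup
of an orientable surface group is conjugacy separable (finite-quotient form), GIVEN the two classical
named facts ("`G` is conjugacy separable … [Stb2], Theorem 3.3", p. 57, applied to the finite-index
subgroups `G₁`).  Re-export of `hcs_of_surfaceFacts` with the instance binder explicit.
[cite: Mochizuki2012, Thm 2.6 p.57] -/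
theorem hcs_surface_of_classicalFacts (hCS : SurfaceGroupConjugacySeparable)
    (hFI : SurfaceGroupFiniteIndexSubgroup) (S : Type u) [Group S] (hS : IsOrientableSurfaceGroup S)
    (K : Subgroup S) (hK : K.FiniteIndex) :
    ∀ u v : K, ¬ IsConj u v → ∃ (L : Subgroup K) (_ : L.Normal) (_ : L.FiniteIndex),
      ¬ IsConj (QuotientGroup.mk u : K ⧸ L) (QuotientGroup.mk v) := by
  haveI := hK
  exact hcs_of_surfaceFacts hCS hFI S hS K

/-! ### The four named statements modulo exactly the two classical facts -/

/-- **[IUTchI] Theorem 2.6 (Profinite Conjugates of Discrete Subgroups) AS TYPED, modulo exactly the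
two classical named facts** `SurfaceGroupConjugacySeparable` ([Stb2] Thm 3.3) and
`SurfaceGroupFiniteIndexSubgroup` (Riemann–Hurwitz): the printed inference of pp. 56–57 with every
[IUTchI]-internal input (Lemma 2.7 (i), (iii), (iv)) discharged by the tree's theorems.
[cite: Mochizuki2012, Thm 2.6 pp.56-57] -/
theorem profiniteConjugatesOfDiscreteSubgroups_of_classicalFacts (hCS : SurfaceGroupConjugacySeparable)
    (hFI : SurfaceGroupFiniteIndexSubgroup) :
    Literature.IUT.HodgeTheaters.ProfiniteConjugatesOfDiscreteSubgroups.{u} :=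
  profiniteConjugatesOfDiscreteSubgroups_of_lemma27 hCS hFI twoGeneratedSubgroupFree_holds
    rankTwoInAbelianization_holds abelianSubgroupCyclic_holds

/-- **[IUTchI] Corollary 2.8 (Subgroups of Topological Fundamental Groups of Complex Hyperbolic Curves)
AS TYPED, modulo exactly the two classical named facts** (Remark 2.8.1: immediate from Theorem 2.6).
[cite: Mochizuki2012, Cor 2.8 p.59] -/
theorem subgroupsOfComplexHyperbolicPi1_of_classicalFacts (hCS : SurfaceGroupConjugacySeparable)
    (hFI : SurfaceGroupFiniteIndexSubgroup) :
    Literature.IUT.HodgeTheaters.SubgroupsOfComplexHyperbolicPi1.{u} :=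
  subgroupsOfComplexHyperbolicPi1_of_lemma27 hCS hFI twoGeneratedSubgroupFree_holds
    rankTwoInAbelianization_holds abelianSubgroupCyclic_holds

/-- **[IUTchI] Lemma 2.7 (vi) AS TYPED (the centralizer `Z_Ĝ(N̂)` of `N̂ = Ker(Ĝ ↠ Ĝ^{ab})` is
trivial), modulo exactly the two classical named facts.** [cite: Mochizuki2012, Lem 2.7(vi) p.58] -/
theorem centralizerCommutatorKernelTrivial_of_classicalFacts (hCS : SurfaceGroupConjugacySeparable)
    (hFI : SurfaceGroupFiniteIndexSubgroup) :
    Literature.IUT.HodgeTheaters.FreeOrSurface.centralizerCommutatorKernelTrivial.{u} :=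
  centralizerCommutatorKernelTrivial_of_lemma27 hCS hFI twoGeneratedSubgroupFree_holds
    rankTwoInAbelianization_holds abelianSubgroupCyclic_holds

/-- **[IUTchI] Lemma 2.7 (vii) AS TYPED (an automorphism of `Ĝ` fixing `N̂` pointwise is the
identity), modulo exactly the two classical named facts** ((vi) ⇒ (vii), p. 59).
[cite: Mochizuki2012, Lem 2.7(vii) p.58] -/
theorem autFixingCommutatorKernelTrivial_of_classicalFacts (hCS : SurfaceGroupConjugacySeparable)
    (hFI : SurfaceGroupFiniteIndexSubgroup) :
    Literature.IUT.HodgeTheaters.FreeOrSurface.autFixingCommutatorKernelTrivial.{u} :=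
  autFixingCommutatorKernelTrivial_of_lemma27 hCS hFI twoGeneratedSubgroupFree_holds
    rankTwoInAbelianization_holds abelianSubgroupCyclic_holds

end FreeOrSurface

end Literature.IUT.HodgeTheaters
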